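import Literature.Analysis.FluidPDE.TypeIAncientMildClassical
import Literature.Analysis.FluidPDE.PineauVicolRSSChaeWolf
import Literature.Analysis.FluidPDE.PineauVicolCylinderRegularity
import Literature.Analysis.FluidPDE.PineauVicolLerayBounds
import HarnessLib

/-!
# Scale-invariant derivative bounds for Type I solutions and for the KNSS-gauge Type I class
  (Chae–Wolf 2017, (3.6); Pineau–Vicol 2026, Lemma 7.1, (7.2))

Analysis/FluidPDE proofs file (theorems only; no definitions, no named facts). Chae–Wolf
(Comm. PDE 42 (2017) = arXiv:1610.09464, §3, p. 8) record, for a smooth solution of the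
Navier–Stokes equations on `ℝ³ × (−∞, 0)` with the Type I space–time envelope
`|u(x,t)| ≤ C_*/(√(−t) + |x|)` ((3.5)), the a priori estimates

  (3.6)  `|∇ˡ u(x,t)| ≤ C_l / ((−t)^{(1+l)/2} + |x|^{1+l})`,  all `l ∈ ℕ`,

"by using the regularity theory of the Navier–Stokes equations". Pineau–Vicol (arXiv:2607.09619,
2026, Lemma 7.1 and its proof, eq. (7.2), p. 24) print the same bounds in similarity variables,
`|∇ᵏ_y U(y,s)| ≤ C_{U,k}/(1+|y|)^{k+1}` for all `k ≥ 0`, uniformly in the rotation rate, with the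
proof: rescale to unit parabolic cylinders on which the envelope bounds the velocity by `C_{U,0}`,
apply quantitative interior regularity (Serrin 1962), undo the rescaling. That proof is the tree's
`PineauVicol2026.exists_forall_iteratedFDeriv_le_of_typeI` (`PineauVicolCylinderRegularity`), stated
for CLASSICAL solutions `(u, p)` on `(−∞, 0)` with a class-uniform constant `K(n, C₀)` and the
weight `max{|x|, √(−t)}^{−(n+1)}`.

This file only repackages that theorem:

* `chaeWolf2017_derivativeDecay` — (3.6) AS PRINTED (the weight `(−t)^{(1+l)/2} + |x|^{1+l}`, with
  `(−t)^{(1+l)/2}` written `√(−t)^{l+1}`), class-uniform constant;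
* `IsTypeIAncientMild.exists_forall_norm_iteratedFDeriv_le_of_hasTypeIDecay` — (3.6)/(7.2) for the
  KNSS-gauge Type I class `IsTypeIAncientMild C V` (`TypeIAncientMild.lean`: jointly smooth on
  `t < 0`, divergence free, mild between all pairs of negative times, `|V| ≤ C/√(−t)`) under the
  space–time envelope `HasTypeIDecay C V`, weight `max{|x|, √(−t)}`. The one step beyond the cited
  theorem: such a field is a classical solution on the whole past `(−∞, 0)` for ONE smooth pressure
  — classical on every window `(t₀, 0)` (`IsTypeIAncientMild.exists_isClassicalNSSolutionOn_Ioo`,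
  Fabes–Jones–Rivière) and the window pressures patch after normalisation at the origin
  (`IsClassicalNSSolutionOn.exists_pressure_Iio_of_Ioo`); the same assembly exists summit-side
  (e.g. `exists_isClassicalNSSolutionOn_Iio_of_isTypeIAncientMild` in Theorems files of
  NavierStokesRegularity), and is inlined here because Literature may not import Summits;
* `IsTypeIAncientMild.exists_forall_pow_mul_norm_iteratedFDeriv_le_of_hasTypeIDecay` — the same as
  the scale-invariant gauge bound `(|x| + √(−t))^{n+1} |Dⁿ V(t,x)| ≤ K`, every order `n`, `K`
  depending on `n` and `C` only;
* `IsTypeIAncientMild.gaugeBounds_of_hasTypeIDecay` — orders `1, 2, 3` bundled in the literal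
  shape in which summit-side files of NavierStokesRegularity take these bounds as a hypothesis;
* (appended) `IsTypeIAncientMild.exists_forall_norm_iteratedFDeriv_lerayOrbit_le_of_hasTypeIDecay`,
  `…pow_mul_norm_iteratedFDeriv_lerayOrbit_le…` — (7.2) in Leray variables for the class: the
  profile `U = lerayOrbit V` has `‖DⁿU(s,·)(y)‖ ≤ K max{|y|,1}^{−(n+1)}`, resp.
  `(1+|y|)^{n+1}‖DⁿU(s,·)(y)‖ ≤ K`, uniformly in `s ∈ ℝ`.

Nothing here is specific to self-similar or discretely self-similar fields.

## References

* D. Chae, J. Wolf, *Removing discretely self-similar singularities for the 3D Navier–Stokes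
  equations*, Comm. PDE 42 (2017) 1359–1374 = arXiv:1610.09464, §3, (3.5)–(3.6), p. 8.
  [ChaeWolf2017RemovingDSS]
* B. Pineau, V. Vicol, arXiv:2607.09619 (2026), Lemma 7.1 and its proof, (7.2), p. 24; Lemma 2.1,
  (2.1), p. 9. [PineauVicol2026]
* E. B. Fabes, B. F. Jones, N. M. Rivière, Arch. Rational Mech. Anal. 45 (1972), Thm. 2.1.
  [FabesJonesRiviere1972]
* G. Koch, N. Nadirashvili, G. Seregin, V. Šverák, Acta Math. 203 (2009) = arXiv:0709.3599, §4.
  [KochNadirashviliSereginSverak2009]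
-/

noncomputable section

open Set Function

namespace Literature.Analysis.FluidPDE

/-! ### Chae–Wolf (3.6) for classical Type I solutions on `(−∞, 0)` -/

/-- Elementary: for `a ≥ 0`, `b > 0`, `(max a b)⁻¹ ^ (n+1) ≤ 2 / (b ^ (n+1) + a ^ (n+1))`.
[folklore] -/
private theorem inv_max_pow_le_two_div {a b : ℝ} (ha : 0 ≤ a) (hb : 0 < b) (n : ℕ) :
    ((max a b)⁻¹) ^ (n + 1) ≤ 2 / (b ^ (n + 1) + a ^ (n + 1)) := by
  have hm : 0 < max a b := lt_max_of_lt_right hb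
  have hmp : 0 < (max a b) ^ (n + 1) := pow_pos hm _
  have hden : 0 < b ^ (n + 1) + a ^ (n + 1) := by positivity
  have h1 : a ^ (n + 1) ≤ (max a b) ^ (n + 1) := pow_le_pow_left₀ ha (le_max_left _ _) _
  have h2 : b ^ (n + 1) ≤ (max a b) ^ (n + 1) := pow_le_pow_left₀ hb.le (le_max_right _ _) _
  rw [inv_pow, inv_eq_one_div, div_le_div_iff₀ hmp hden]
  nlinarith

/-- Elementary: for `a ≥ 0`, `b > 0`, `(a + b) ^ (n+1) * (max a b)⁻¹ ^ (n+1) ≤ 2 ^ (n+1)`.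
[folklore] -/
private theorem add_pow_mul_inv_max_pow_le {a b : ℝ} (ha : 0 ≤ a) (hb : 0 < b) (n : ℕ) :
    (a + b) ^ (n + 1) * ((max a b)⁻¹) ^ (n + 1) ≤ 2 ^ (n + 1) := by
  have hm : 0 < max a b := lt_max_of_lt_right hb
  have hsum : a + b ≤ 2 * max a b := by
    have := le_max_left a b
    have := le_max_right a b
    linarith
  have hsum0 : 0 ≤ a + b := by linarith
  calc (a + b) ^ (n + 1) * ((max a b)⁻¹) ^ (n + 1)
      = ((a + b) * (max a b)⁻¹) ^ (n + 1) := by rw [mul_pow]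
    _ ≤ (2 : ℝ) ^ (n + 1) := by
        refine pow_le_pow_left₀ (mul_nonneg hsum0 (inv_nonneg.2 hm.le)) ?_ _
        rw [mul_inv_le_iff₀ hm]
        linarith

/-- **Chae–Wolf 2017, (3.6)** (= Pineau–Vicol 2026, Lemma 7.1 (7.2), in physical variables).
For every order `n` and every Type I constant `C₀` there is `C_n ≥ 0` such that every classical
solution `(u, p)` of the Navier–Stokes equations (`ν = 1`, no force) on `ℝ³ × (−∞, 0)` with the
Type I space–time envelope `|u(x,t)| ≤ C₀/(|x| + √(−t))` (`HasTypeIDecay C₀ u`) satisfies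
`|Dⁿ u(t,·)(x)| ≤ C_n / (√(−t)^{n+1} + |x|^{n+1})` for all `t < 0`, `x` — "by using the regularity
theory of the Navier–Stokes equations we infer for all `l ∈ ℕ`,
`|∇ˡu(x,t)| ≤ C_l/((−t)^{(1+l)/2} + |x|^{1+l})`". The regularity theory is the tree's quantitative
interior bootstrap on rescaled unit cylinders,
`PineauVicol2026.exists_forall_iteratedFDeriv_le_of_typeI` (weight `max{|x|, √(−t)}`); here only
`max{a,b}^{n+1} ≥ (a^{n+1} + b^{n+1})/2`. The printed standing assumption `u ∈ C((−∞,0); Lᵖ)` is not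
used. [cite: ChaeWolf2017RemovingDSS, §3 eq. (3.6) (arXiv:1610.09464 p. 8)] -/
theorem chaeWolf2017_derivativeDecay (n : ℕ) (C₀ : ℝ) :
    ∃ C : ℝ, 0 ≤ C ∧
      ∀ (u : ℝ → EuclideanSpace ℝ (Fin 3) → EuclideanSpace ℝ (Fin 3))
        (p : ℝ → EuclideanSpace ℝ (Fin 3) → ℝ),
      IsClassicalNSSolutionOn (Iio 0) 1 0 u p → HasTypeIDecay C₀ u →
      ∀ t < 0, ∀ x : EuclideanSpace ℝ (Fin 3),
        ‖iteratedFDeriv ℝ n (u t) x‖ ≤ C / (Real.sqrt (-t) ^ (n + 1) + ‖x‖ ^ (n + 1)) := by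
  obtain ⟨K, hK0, hK⟩ := PineauVicol2026.exists_forall_iteratedFDeriv_le_of_typeI n C₀
  refine ⟨2 * K, by positivity, fun u p hsol hdec t ht x => ?_⟩
  have hb : 0 < Real.sqrt (-t) := Real.sqrt_pos.2 (neg_pos.2 ht)
  have h := hK u p hsol (fun s hs y => hdec s hs y) t ht x
  refine h.trans ?_
  have h2 := inv_max_pow_le_two_div (norm_nonneg x) hb n
  calc K * ((max ‖x‖ (Real.sqrt (-t)))⁻¹) ^ (n + 1)
      ≤ K * (2 / (Real.sqrt (-t) ^ (n + 1) + ‖x‖ ^ (n + 1))) :=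
        mul_le_mul_of_nonneg_left h2 hK0
    _ = 2 * K / (Real.sqrt (-t) ^ (n + 1) + ‖x‖ ^ (n + 1)) := by ring

/-! ### Chae–Wolf (3.6) / Pineau–Vicol (7.2) on the KNSS-gauge Type I class -/

/-- **(3.6)/(7.2) on the KNSS-gauge class, weight `max{|x|, √(−t)}`.** For every `n`, `C` there
is `K ≥ 0` with `‖Dⁿ V(t,·)(x)‖ ≤ K · max{|x|, √(−t)}^{−(n+1)}` for every field of the class
`IsTypeIAncientMild C V` with the space–time envelope `HasTypeIDecay C V`, every `t < 0` and `x`: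
`V` is classical on `(−∞, 0)` for one pressure (windows `(−(k+1), 0)` by
`IsTypeIAncientMild.exists_isClassicalNSSolutionOn_Ioo`, patched by
`IsClassicalNSSolutionOn.exists_pressure_Iio_of_Ioo`), so
`PineauVicol2026.exists_forall_iteratedFDeriv_le_of_typeI` applies. [cite: ChaeWolf2017RemovingDSS, §3 eq. (3.6) (arXiv:1610.09464 p. 8)] -/
theorem IsTypeIAncientMild.exists_forall_norm_iteratedFDeriv_le_of_hasTypeIDecay (n : ℕ) (C : ℝ) :
    ∃ K : ℝ, 0 ≤ K ∧ ∀ ⦃V : ℝ → EuclideanSpace ℝ (Fin 3) → EuclideanSpace ℝ (Fin 3)⦄,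
      IsTypeIAncientMild C V → HasTypeIDecay C V →
      ∀ t < 0, ∀ x : EuclideanSpace ℝ (Fin 3),
        ‖iteratedFDeriv ℝ n (V t) x‖ ≤ K * ((max ‖x‖ (Real.sqrt (-t)))⁻¹) ^ (n + 1) := by
  obtain ⟨K, hK0, hK⟩ := PineauVicol2026.exists_forall_iteratedFDeriv_le_of_typeI n C
  refine ⟨K, hK0, fun V hV hdec t ht x => ?_⟩
  -- one pressure on the whole past: classical on the windows `(−(k+1), 0)` (Fabes–Jones–Rivière),
  -- patched after normalisation at the origin
  have hwin : ∀ k : ℕ, ∃ q : ℝ → EuclideanSpace ℝ (Fin 3) → ℝ,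
      IsClassicalNSSolutionOn (Ioo (-((k : ℝ) + 1)) 0) 1 0 V q := fun k =>
    hV.exists_isClassicalNSSolutionOn_Ioo (t₀ := -((k : ℝ) + 1)) (by
      have : (0 : ℝ) ≤ k := Nat.cast_nonneg k
      linarith)
  choose q hq using hwin
  obtain ⟨P, hP⟩ : ∃ P : ℝ → EuclideanSpace ℝ (Fin 3) → ℝ,
      IsClassicalNSSolutionOn (Iio 0) 1 0 V P := by
    refine IsClassicalNSSolutionOn.exists_pressure_Iio_of_Ioo (a := fun k : ℕ => -((k : ℝ) + 1)) hq
      fun s hs => ⟨⌈-s⌉₊, ?_⟩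
    have h1 : -s ≤ (⌈-s⌉₊ : ℝ) := Nat.le_ceil (-s)
    show -((⌈-s⌉₊ : ℝ) + 1) < s
    linarith
  exact hK V P hP (fun s hs y => hdec s hs y) t ht x

/-- **The scale-invariant gauge bounds of every order on the KNSS-gauge Type I class.** For every
`n`, `C` there is `K` with `(|x| + √(−t))^{n+1} ‖Dⁿ V(t,·)(x)‖ ≤ K` for every field of the class
`IsTypeIAncientMild C V` with the envelope `HasTypeIDecay C V`, every `t < 0` and `x` (Chae–Wolf
(3.6) / Pineau–Vicol (7.2) with `|x| + √(−t) ≤ 2 max{|x|, √(−t)}`, costing the factor `2^{n+1}`).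
[cite: ChaeWolf2017RemovingDSS, §3 eq. (3.6) (arXiv:1610.09464 p. 8)] -/
theorem IsTypeIAncientMild.exists_forall_pow_mul_norm_iteratedFDeriv_le_of_hasTypeIDecay
    (n : ℕ) (C : ℝ) :
    ∃ K : ℝ, 0 ≤ K ∧ ∀ ⦃V : ℝ → EuclideanSpace ℝ (Fin 3) → EuclideanSpace ℝ (Fin 3)⦄,
      IsTypeIAncientMild C V → HasTypeIDecay C V →
      ∀ t < 0, ∀ x : EuclideanSpace ℝ (Fin 3),
        (‖x‖ + Real.sqrt (-t)) ^ (n + 1) * ‖iteratedFDeriv ℝ n (V t) x‖ ≤ K := by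
  obtain ⟨K, hK0, hK⟩ :=
    IsTypeIAncientMild.exists_forall_norm_iteratedFDeriv_le_of_hasTypeIDecay n C
  refine ⟨2 ^ (n + 1) * K, by positivity, fun V hV hdec t ht x => ?_⟩
  have hb : 0 < Real.sqrt (-t) := Real.sqrt_pos.2 (neg_pos.2 ht)
  have h := hK hV hdec t ht x
  have hw : 0 ≤ (‖x‖ + Real.sqrt (-t)) ^ (n + 1) := by positivity
  calc (‖x‖ + Real.sqrt (-t)) ^ (n + 1) * ‖iteratedFDeriv ℝ n (V t) x‖
      ≤ (‖x‖ + Real.sqrt (-t)) ^ (n + 1) * (K * ((max ‖x‖ (Real.sqrt (-t)))⁻¹) ^ (n + 1)) :=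
        mul_le_mul_of_nonneg_left h hw
    _ = K * ((‖x‖ + Real.sqrt (-t)) ^ (n + 1) * ((max ‖x‖ (Real.sqrt (-t)))⁻¹) ^ (n + 1)) := by
        ring
    _ ≤ K * 2 ^ (n + 1) :=
        mul_le_mul_of_nonneg_left (add_pow_mul_inv_max_pow_le (norm_nonneg x) hb n) hK0
    _ = 2 ^ (n + 1) * K := by ring

/-- **Orders `1, 2, 3` bundled, per field.** Every field of the KNSS-gauge Type I class
`IsTypeIAncientMild M V` with the space–time envelope `HasTypeIDecay M V` admits constants
`C₁, C₂, C₃` with `(|x| + √(−t))^{k+1} ‖Dᵏ V(t,·)(x)‖ ≤ C_k`, `k = 1, 2, 3`, for all `t < 0`, `x`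
(Chae–Wolf (3.6) for `l = 1, 2, 3`; this is the literal shape in which summit-side files of
NavierStokesRegularity take the gauge bounds as a hypothesis, so that the hypothesis is now a
theorem of the class). [cite: ChaeWolf2017RemovingDSS, §3 eq. (3.6) (arXiv:1610.09464 p. 8)] -/
theorem IsTypeIAncientMild.gaugeBounds_of_hasTypeIDecay :
    ∀ ⦃M : ℝ⦄ ⦃V : ℝ → EuclideanSpace ℝ (Fin 3) → EuclideanSpace ℝ (Fin 3)⦄,
      IsTypeIAncientMild M V → HasTypeIDecay M V →
      ∃ C₁ C₂ C₃ : ℝ,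
        (∀ t < 0, ∀ x, (‖x‖ + Real.sqrt (-t)) ^ (1 + 1) * ‖iteratedFDeriv ℝ 1 (V t) x‖ ≤ C₁) ∧
        (∀ t < 0, ∀ x, (‖x‖ + Real.sqrt (-t)) ^ (2 + 1) * ‖iteratedFDeriv ℝ 2 (V t) x‖ ≤ C₂) ∧
        (∀ t < 0, ∀ x, (‖x‖ + Real.sqrt (-t)) ^ (3 + 1) * ‖iteratedFDeriv ℝ 3 (V t) x‖ ≤ C₃) := by
  intro M V hV hdec
  obtain ⟨C₁, -, h₁⟩ :=
    IsTypeIAncientMild.exists_forall_pow_mul_norm_iteratedFDeriv_le_of_hasTypeIDecay 1 M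
  obtain ⟨C₂, -, h₂⟩ :=
    IsTypeIAncientMild.exists_forall_pow_mul_norm_iteratedFDeriv_le_of_hasTypeIDecay 2 M
  obtain ⟨C₃, -, h₃⟩ :=
    IsTypeIAncientMild.exists_forall_pow_mul_norm_iteratedFDeriv_le_of_hasTypeIDecay 3 M
  exact ⟨C₁, C₂, C₃, h₁ hV hdec, h₂ hV hdec, h₃ hV hdec⟩


/-! ### Pineau–Vicol (7.2) in Leray variables on the KNSS-gauge Type I class (appended) -/

/-- **Pineau–Vicol 2026, Lemma 7.1 (7.2), in Leray variables, on the KNSS-gauge class.** For every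
`n`, `C` there is `K ≥ 0` such that for every field of the class `IsTypeIAncientMild C V` with the
space–time envelope `HasTypeIDecay C V`, the backward similarity profile
`U(s, y) = e^{−s/2} V(−e^{−s}, e^{−s/2} y)` (`lerayOrbit V`) obeys
`‖Dⁿ_y U(s,·)(y)‖ ≤ K · max{|y|, 1}^{−(n+1)}` for ALL `s ∈ ℝ` and `y` — the source's
"`|∇ᵏ_y U(y,s)| ≤ C_{U,k}/(1+|y|)^{k+1}` … for all `(y,s)`", uniformly in `s`, with the weight
`max{|y|,1}` of the tree's `PineauVicol2026.exists_forall_iteratedFDeriv_lerayOrbit_le` (classical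
solutions on `(−∞,0)`), to which the class is reduced by the global classical representative as
above. [cite: PineauVicol2026, Lemma 7.1, proof, eq. (7.2) (arXiv:2607.09619 p. 24)] -/
theorem IsTypeIAncientMild.exists_forall_norm_iteratedFDeriv_lerayOrbit_le_of_hasTypeIDecay
    (n : ℕ) (C : ℝ) :
    ∃ K : ℝ, 0 ≤ K ∧ ∀ ⦃V : ℝ → EuclideanSpace ℝ (Fin 3) → EuclideanSpace ℝ (Fin 3)⦄,
      IsTypeIAncientMild C V → HasTypeIDecay C V →
      ∀ (s : ℝ) (y : EuclideanSpace ℝ (Fin 3)),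
        ‖iteratedFDeriv ℝ n (lerayOrbit V s) y‖ ≤ K * ((max ‖y‖ 1)⁻¹) ^ (n + 1) := by
  obtain ⟨K, hK0, hK⟩ := PineauVicol2026.exists_forall_iteratedFDeriv_lerayOrbit_le n C
  refine ⟨K, hK0, fun V hV hdec s y => ?_⟩
  have hwin : ∀ k : ℕ, ∃ q : ℝ → EuclideanSpace ℝ (Fin 3) → ℝ,
      IsClassicalNSSolutionOn (Ioo (-((k : ℝ) + 1)) 0) 1 0 V q := fun k =>
    hV.exists_isClassicalNSSolutionOn_Ioo (t₀ := -((k : ℝ) + 1)) (by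
      have : (0 : ℝ) ≤ k := Nat.cast_nonneg k
      linarith)
  choose q hq using hwin
  obtain ⟨P, hP⟩ : ∃ P : ℝ → EuclideanSpace ℝ (Fin 3) → ℝ,
      IsClassicalNSSolutionOn (Iio 0) 1 0 V P := by
    refine IsClassicalNSSolutionOn.exists_pressure_Iio_of_Ioo (a := fun k : ℕ => -((k : ℝ) + 1)) hq
      fun t ht => ⟨⌈-t⌉₊, ?_⟩
    have h1 : -t ≤ (⌈-t⌉₊ : ℝ) := Nat.le_ceil (-t)
    show -((⌈-t⌉₊ : ℝ) + 1) < t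
    linarith
  exact hK V P hP (fun t ht x => hdec t ht x) s y

/-- The same bound in the printed shape `(1 + |y|)^{n+1} ‖Dⁿ_y U(s,·)(y)‖ ≤ C_{U,n}` (every order
`n`, all `s`, constant depending on `n` and `C` only; `1 + |y| ≤ 2 max{|y|, 1}` costs `2^{n+1}`).
[cite: PineauVicol2026, Lemma 7.1, proof, eq. (7.2) (arXiv:2607.09619 p. 24)] -/
theorem IsTypeIAncientMild.exists_forall_pow_mul_norm_iteratedFDeriv_lerayOrbit_le_of_hasTypeIDecay
    (n : ℕ) (C : ℝ) :
    ∃ K : ℝ, 0 ≤ K ∧ ∀ ⦃V : ℝ → EuclideanSpace ℝ (Fin 3) → EuclideanSpace ℝ (Fin 3)⦄,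
      IsTypeIAncientMild C V → HasTypeIDecay C V →
      ∀ (s : ℝ) (y : EuclideanSpace ℝ (Fin 3)),
        (1 + ‖y‖) ^ (n + 1) * ‖iteratedFDeriv ℝ n (lerayOrbit V s) y‖ ≤ K := by
  obtain ⟨K, hK0, hK⟩ :=
    IsTypeIAncientMild.exists_forall_norm_iteratedFDeriv_lerayOrbit_le_of_hasTypeIDecay n C
  refine ⟨2 ^ (n + 1) * K, by positivity, fun V hV hdec s y => ?_⟩
  have h := hK hV hdec s y
  have hw : 0 ≤ (1 + ‖y‖) ^ (n + 1) := by positivity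
  have hk := add_pow_mul_inv_max_pow_le (norm_nonneg y) one_pos n
  calc (1 + ‖y‖) ^ (n + 1) * ‖iteratedFDeriv ℝ n (lerayOrbit V s) y‖
      ≤ (1 + ‖y‖) ^ (n + 1) * (K * ((max ‖y‖ 1)⁻¹) ^ (n + 1)) :=
        mul_le_mul_of_nonneg_left h hw
    _ = K * ((‖y‖ + 1) ^ (n + 1) * ((max ‖y‖ 1)⁻¹) ^ (n + 1)) := by ring
    _ ≤ K * 2 ^ (n + 1) := mul_le_mul_of_nonneg_left hk hK0
    _ = 2 ^ (n + 1) * K := by ring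

end Literature.Analysis.FluidPDE

end
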